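import Literature.AnabelianGeometry.EtaleTheta.GalSectCuspPairTorsors
import HarnessLib

/-!
# [EtTh] Remark 2.9.2 from the STABILISER CHARACTER on the cusp torsor: transitivity at label `0` / for `X̲`, two
# `μ_l`-orbits at nonzero labels — a reduction over `Cor28iiData` (proof-only)

S. Mochizuki, *The étale theta function and its Frobenioid-theoretic manifestations*, Publ. RIMS **45** (2009)
[MochizukiEtTh2009], §2, Remark 2.9.2, PRIMS PDF p. 43 l. 1–12 (printed p. 269): «In the situation of Corollary 2.8, (ii),
we make the following observation, relative to the labels of Corollary 2.9: The `2l` (respectively, `2`) trivializations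
of the `(K^×)^∧`-torsor at a cusp labeled `0` (respectively, an arbitrary cusp) of `X̲̲^log` (respectively, `X̲^log`)
determined by the `μ_{2l}` (respectively, `μ_2`)-structure under discussion are permuted transitively by the subgroup of
`Aut_K(X̲̲^log)` (respectively, `Aut_K(X̲^log)`) [cf. Remarks 2.1.1, 2.6.1, 2.9.1] that stabilizes the cusp.  In the case of
`X̲̲^log`, at cusps with nonzero labels, the subgroup of the corresponding "`Aut_K(−)`" that stabilizes the cusp permutes
the `2l` trivializations under consideration via the action of `μ_l` [hence has precisely two orbits].»
[cite: MochizukiEtTh2009, Rmk 2.9.2 p.43]; [GalSect] §4 p. 33 (the torsor of splittings at a cusp)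
[cite: MochizukiGalSect2005, §4 p.33].

PROOF-ONLY reduction (theorems only; no `def`, no instance, no `Prop` fact; nothing frozen edited) of abc-iut-w5-d062's
typing `ThetaCovers.TemperedCoverData.Rmk292` (`GalSectCuspPairTorsors.lean`, p421870).  abc-iut cell, layer L2, seat
abc-iut-L2-t12 (gen 10), row «RMK292» (L2 ROWS #142 (5) sizing → #144 R1174 GO (R)).  THE BINDER GAP (R1174 verdict
(2)): `StabTransitive S g R` is group-theoretic (stabiliser representatives `n ∈ N(S)` moving member SPLITTINGS by
conjugation), while the `μ`-structure `R` produced by Cor. 2.8 (ii) is an orbit under the ABSTRACT torsor action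
`TorsorData.act` — and `Cor28iiData` carries no law tying the two.  Print's mechanism supplying the tie («determined by
the `μ_{2l}`-structure … via the action of `μ_l`»: the deck group `Gal(X̲̲/X̲) ≅ μ_l`, totally ramified at the cusps, and
the inversion fixing the `0`-labelled cusp act on the cusp's tangent torsor through a CHARACTER onto `μ_{2l}`, resp.
onto `μ₂`, resp. with image `μ_l`) is stated here as HYPOTHESES BY NAME — the *stabiliser character data* — and the remark
is derived from them:

* `stabTransitive_of_stabChar` (R1) — if `R` is a `B`-orbit of classes (`IsStructure B R`) and every `ζ ∈ B` is
  REALISED on classes by some cusp-stabiliser representative (`hχ`), then the stabiliser acts transitively on the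
  MEMBER SPLITTINGS of `R` (`StabTransitive`): the bookkeeping «classes → splittings» (an `I`-conjugation `i` is
  absorbed into the correction `s ↦ s·i⁻¹`, `I ≤ D ≤ S`);
* `not_stabTransitive_of_stabChar_through` — if every stabiliser move of a member splitting is a `B₁`-move on classes
  and `R ∋ c, act ζ₀ c` with `ζ₀ ∉ B₁` (free action), the stabiliser is NOT transitive on `R`;
* `stabTwoMuOrbits_of_stabChar` (R2) — for `B₁ ≤ B₂` of index two (`ζ₀`-coset decomposition), `R` a `B₂`-orbit, the
  stabiliser realising exactly `B₁`: `R = R₁ ⊔ R₂` with both `B₁`-orbits transitive and `R` not — clause (c);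
* **`rmk292_of_stabChar`** (R3) — `TemperedCoverData.Rmk292 𝒟Xuu RXuu RXu label0` from the three character data
  (label `0`: onto `𝒟Xuu.mu (2l)`; `X̲`: onto a `μ₂`-type structure group of the given `X̲`-torsors; labels `≠ 0`:
  image exactly `𝒟Xuu.mu l` of index two in `𝒟Xuu.mu (2l)`), FQ type.
Class on landing (chair's call, R1174): EtTh:Rmk2.9.2 «R-a AT READING modulo {stabiliser character data ×3} displayed» —
the same footing as the Cor. 2.8 (ii) node's own count («discharged as typed modulo (R, hR, hReq)», R555).  The data are
GENUINE-CURVE inputs (no model in the tree carries a contentful cusp torsor: VNEXT G-L2t12g9-1).  HONEST FRAMING: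
[EtTh]/[GalSect] are refereed; nothing printed is asserted — the character data are hypotheses; typed ≠ proved; no side
taken on [IUTchIII] Cor. 3.12.
-/

noncomputable section

namespace Literature.AnabelianGeometry.EtaleTheta

open scoped Pointwise

namespace ThetaCovers

namespace TemperedCoverData

universe u

variable {l : ℕ} (T : TemperedCoverData.{u} l)

/-! ### (R1) Transitivity on member splittings from a realised structure group -/

/-- The decomposition group of the cuspidal pair at `g` lies in the member `S`. [cite: MochizukiEtTh2009, Cor 2.8 (ii) p.42] -/
theorem cuspPairAt_D_le (S : Subgroup T.Gtp) (g : T.Gtp) : (T.cuspPairAt S g).D ≤ S := inf_le_left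

/-- The correction `s ↦ s·i⁻¹` by an inertia element keeps the `D`-condition of a stabiliser representative.
[cite: MochizukiEtTh2009, Rmk 2.9.2 p.43] -/
theorem conj_mul_inv_smul_D_eq (S : Subgroup T.Gtp) (g : T.Gtp) {s i : T.Gtp} (hi : i ∈ (T.cuspPairAt S g).I) :
    MulAut.conj (s * i⁻¹) • (T.cuspPairAt S g).D = MulAut.conj s • (T.cuspPairAt S g).D := by
  rw [map_mul, mul_smul, map_inv]
  congr 1
  have hiD : i ∈ (T.cuspPairAt S g).D := (T.cuspPairAt S g).I_le hi
  have h := (T.cuspPairAt S g).conj_D_eq hiD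
  -- `conj i⁻¹ • D = D` from `conj i • D = D`
  conv_lhs => rw [← h]
  rw [inv_smul_smul]

/-- **(R1) `StabTransitive` from a REALISED structure group.**  Let `R` be a `B`-structure on the torsor of splitting
classes at the cusp `g` of the member `Z` (`Π^tp_Z = S`) — a `B`-orbit under the abstract action `𝒯.act` — and suppose
every `ζ ∈ B` is realised on classes by a cusp-stabiliser representative `n` with correction `s ∈ S` (the STABILISER
CHARACTER is onto `B`; print: «determined by the μ-structure under discussion»).  Then the cusp stabiliser of `Aut_K(Z)`
permutes the member splittings of `R` transitively. [cite: MochizukiEtTh2009, Rmk 2.9.2 p.43] -/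
theorem stabTransitive_of_stabChar (S : Subgroup T.Gtp) (g : T.Gtp) {A : Type u} [Group A]
    (𝒯 : (T.cuspPairAt S g).TorsorData A) (B : Subgroup A) (R : Set (T.cuspPairAt S g).SplittingClass)
    (hR : 𝒯.IsStructure B R)
    (hχ : ∀ ζ ∈ B, ∃ n ∈ T.cuspStabilizerReps S g, ∃ s ∈ S,
      MulAut.conj n • (T.cuspPairAt S g).D = MulAut.conj s • (T.cuspPairAt S g).D ∧
      ∀ (S₀ : Subgroup T.Gtp) (hS₀ : S₀ ∈ (T.cuspPairAt S g).splittings),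
        ∃ h₀ : T.stabAct n s S₀ ∈ (T.cuspPairAt S g).splittings,
          GalSect.CuspPair.SplittingClass.mk _ (T.stabAct n s S₀) h₀ =
            𝒯.act ζ (GalSect.CuspPair.SplittingClass.mk _ S₀ hS₀)) :
    T.StabTransitive S g R := by
  intro S₁ hS₁ S₂ hS₂
  obtain ⟨hS₁s, hc₁⟩ := hS₁
  obtain ⟨hS₂s, hc₂⟩ := hS₂
  obtain ⟨c, -, hRc⟩ := hR
  -- the two classes are `B`-translates of the base class
  have h₁ : GalSect.CuspPair.SplittingClass.mk _ S₁ hS₁s ∈ {c' | ∃ b ∈ B, c' = 𝒯.act b c} := hRc ▸ hc₁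
  have h₂ : GalSect.CuspPair.SplittingClass.mk _ S₂ hS₂s ∈ {c' | ∃ b ∈ B, c' = 𝒯.act b c} := hRc ▸ hc₂
  obtain ⟨b₁, hb₁, e₁⟩ := h₁
  obtain ⟨b₂, hb₂, e₂⟩ := h₂
  -- `ζ := b₂ b₁⁻¹` carries the class of `S₁` to the class of `S₂`
  have hζ : 𝒯.act (b₂ * b₁⁻¹) (GalSect.CuspPair.SplittingClass.mk _ S₁ hS₁s) =
      GalSect.CuspPair.SplittingClass.mk _ S₂ hS₂s := by
    rw [e₁, e₂, ← 𝒯.act_mul, mul_assoc, inv_mul_cancel, mul_one]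
  obtain ⟨n, hn, s, hs, hD, hmove⟩ := hχ (b₂ * b₁⁻¹) (B.mul_mem hb₂ (B.inv_mem hb₁))
  obtain ⟨h₀, hcl⟩ := hmove S₁ hS₁s
  rw [hζ] at hcl
  -- same class ⇒ `I`-conjugate: `S₂ = i · (stabAct n s S₁) · i⁻¹`
  obtain ⟨i, hi, hS₂eq⟩ : (T.cuspPairAt S g).InertiaConj (T.stabAct n s S₁) S₂ := Quotient.exact hcl
  refine ⟨n, hn, s * i⁻¹, S.mul_mem hs (S.inv_mem (T.cuspPairAt_D_le S g ((T.cuspPairAt S g).I_le hi))),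
    hD.trans (T.conj_mul_inv_smul_D_eq S g hi).symm, ?_⟩
  rw [hS₂eq]
  change MulAut.conj ((s * i⁻¹)⁻¹ * n) • S₁ = MulAut.conj i • (MulAut.conj (s⁻¹ * n) • S₁)
  rw [← mul_smul, ← map_mul, mul_inv_rev, inv_inv, mul_assoc]

/-! ### (R2) Two `μ_l`-orbits at nonzero labels -/

/-- **No transitivity when the stabiliser acts THROUGH a proper subgroup**: if every stabiliser move of a member
splitting of `R` is a `B₁`-move on classes, and `R` contains two classes `c`, `act ζ₀ c` with `ζ₀ ∉ B₁`, then the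
stabiliser is not transitive on the members of `R` (the torsor action is free). [cite: MochizukiEtTh2009, Rmk 2.9.2 p.43] -/
theorem not_stabTransitive_of_stabChar_through (S : Subgroup T.Gtp) (g : T.Gtp) {A : Type u} [Group A]
    (𝒯 : (T.cuspPairAt S g).TorsorData A) (B₁ : Subgroup A) (R : Set (T.cuspPairAt S g).SplittingClass)
    (hthrough : ∀ n ∈ T.cuspStabilizerReps S g, ∀ s ∈ S,
      MulAut.conj n • (T.cuspPairAt S g).D = MulAut.conj s • (T.cuspPairAt S g).D →
      ∀ (S₀ : Subgroup T.Gtp) (hS₀ : S₀ ∈ (T.cuspPairAt S g).splittings)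
        (h₀ : T.stabAct n s S₀ ∈ (T.cuspPairAt S g).splittings),
        GalSect.CuspPair.SplittingClass.mk _ S₀ hS₀ ∈ R →
        ∃ ζ ∈ B₁, GalSect.CuspPair.SplittingClass.mk _ (T.stabAct n s S₀) h₀ =
          𝒯.act ζ (GalSect.CuspPair.SplittingClass.mk _ S₀ hS₀))
    {c : (T.cuspPairAt S g).SplittingClass} (hc : c ∈ R) {ζ₀ : A} (hζ₀ : ζ₀ ∉ B₁) (hc' : 𝒯.act ζ₀ c ∈ R) :
    ¬ T.StabTransitive S g R := by
  intro h
  obtain ⟨S₀, hS₀, rfl⟩ := GalSect.CuspPair.SplittingClass.exists_rep _ c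
  obtain ⟨S₀', hS₀', e'⟩ := GalSect.CuspPair.SplittingClass.exists_rep _
    (𝒯.act ζ₀ (GalSect.CuspPair.SplittingClass.mk _ S₀ hS₀))
  obtain ⟨n, hn, s, hs, hD, hmove⟩ := h S₀ ⟨hS₀, hc⟩ S₀' ⟨hS₀', e'.symm ▸ hc'⟩
  have h₀ : T.stabAct n s S₀ ∈ (T.cuspPairAt S g).splittings := hmove ▸ hS₀'
  obtain ⟨ζ, hζ, hcl⟩ := hthrough n hn s hs hD S₀ hS₀ h₀ hc
  have e'' : GalSect.CuspPair.SplittingClass.mk _ (T.stabAct n s S₀) h₀ =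
      GalSect.CuspPair.SplittingClass.mk _ S₀' hS₀' := by
    congr 1
  rw [e'', e'] at hcl
  -- freeness: `act ζ₀ c = act ζ c` forces `ζ₀ = ζ ∈ B₁`
  obtain ⟨a, -, huniq⟩ := 𝒯.existsUnique_act_eq (GalSect.CuspPair.SplittingClass.mk _ S₀ hS₀)
    (𝒯.act ζ₀ (GalSect.CuspPair.SplittingClass.mk _ S₀ hS₀))
  have := (huniq ζ₀ rfl).trans (huniq ζ hcl.symm).symm
  exact hζ₀ (this ▸ hζ)

/-- **(R2) Two `μ_l`-orbits from a stabiliser character with image of index two.**  Let `B₁ ≤ B₂ ≤ A` with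
`B₂ = B₁ ⊔ B₁·ζ₀`, `ζ₀ ∉ B₁` (print: `μ_l ≤ μ_{2l}`, `l` odd), `R` a `B₂`-structure at the cusp `g`, and suppose the cusp
stabiliser realises every `ζ ∈ B₁` on classes (`hχ₁`) and acts on members of `R` only through `B₁` (`hthrough`).  Then `R`
is the disjoint union of two `B₁`-structures, each permuted transitively by the stabiliser, while the stabiliser is
not transitive on `R` — «permutes the `2l` trivializations … via the action of `μ_l` [hence has precisely two orbits]».
[cite: MochizukiEtTh2009, Rmk 2.9.2 p.43] -/
theorem stabTwoMuOrbits_of_stabChar (S : Subgroup T.Gtp) (g : T.Gtp) {A : Type u} [Group A]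
    (𝒯 : (T.cuspPairAt S g).TorsorData A) (B₁ B₂ : Subgroup A) (hle : B₁ ≤ B₂) {ζ₀ : A} (hζ₀B : ζ₀ ∈ B₂)
    (hζ₀ : ζ₀ ∉ B₁) (hcoset : ∀ ζ ∈ B₂, ζ ∈ B₁ ∨ ζ * ζ₀⁻¹ ∈ B₁)
    (R : Set (T.cuspPairAt S g).SplittingClass) (hR : 𝒯.IsStructure B₂ R)
    (hχ₁ : ∀ ζ ∈ B₁, ∃ n ∈ T.cuspStabilizerReps S g, ∃ s ∈ S,
      MulAut.conj n • (T.cuspPairAt S g).D = MulAut.conj s • (T.cuspPairAt S g).D ∧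
      ∀ (S₀ : Subgroup T.Gtp) (hS₀ : S₀ ∈ (T.cuspPairAt S g).splittings),
        ∃ h₀ : T.stabAct n s S₀ ∈ (T.cuspPairAt S g).splittings,
          GalSect.CuspPair.SplittingClass.mk _ (T.stabAct n s S₀) h₀ =
            𝒯.act ζ (GalSect.CuspPair.SplittingClass.mk _ S₀ hS₀))
    (hthrough : ∀ n ∈ T.cuspStabilizerReps S g, ∀ s ∈ S,
      MulAut.conj n • (T.cuspPairAt S g).D = MulAut.conj s • (T.cuspPairAt S g).D →
      ∀ (S₀ : Subgroup T.Gtp) (hS₀ : S₀ ∈ (T.cuspPairAt S g).splittings)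
        (h₀ : T.stabAct n s S₀ ∈ (T.cuspPairAt S g).splittings),
        GalSect.CuspPair.SplittingClass.mk _ S₀ hS₀ ∈ R →
        ∃ ζ ∈ B₁, GalSect.CuspPair.SplittingClass.mk _ (T.stabAct n s S₀) h₀ =
          𝒯.act ζ (GalSect.CuspPair.SplittingClass.mk _ S₀ hS₀)) :
    T.StabTwoMuOrbits S g 𝒯 B₁ R := by
  obtain ⟨c, hcR, hRc⟩ := hR
  -- the two `B₁`-orbits
  let R₁ : Set (T.cuspPairAt S g).SplittingClass := {c' | ∃ b ∈ B₁, c' = 𝒯.act b c}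
  let R₂ : Set (T.cuspPairAt S g).SplittingClass := {c' | ∃ b ∈ B₁, c' = 𝒯.act b (𝒯.act ζ₀ c)}
  have hR₁R : R₁ ⊆ R := by
    rintro _ ⟨b, hb, rfl⟩; rw [hRc]; exact ⟨b, hle hb, rfl⟩
  have hR₂R : R₂ ⊆ R := by
    rintro _ ⟨b, hb, rfl⟩; rw [hRc]; exact ⟨b * ζ₀, B₂.mul_mem (hle hb) hζ₀B, by rw [𝒯.act_mul]⟩
  have hunion : R = R₁ ∪ R₂ := by
    refine Set.Subset.antisymm ?_ (Set.union_subset hR₁R hR₂R)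
    intro c' hc'
    rw [hRc] at hc'
    obtain ⟨b, hb, rfl⟩ := hc'
    rcases hcoset b hb with hb₁ | hb₁
    · exact Or.inl ⟨b, hb₁, rfl⟩
    · refine Or.inr ⟨b * ζ₀⁻¹, hb₁, ?_⟩
      rw [← 𝒯.act_mul, mul_assoc, inv_mul_cancel, mul_one]
  have hdisj : Disjoint R₁ R₂ := by
    refine Set.disjoint_left.mpr ?_
    rintro _ ⟨b, hb, rfl⟩ ⟨b', hb', e⟩
    -- `act b c = act (b' ζ₀) c` ⇒ `b = b' ζ₀` ⇒ `ζ₀ ∈ B₁`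
    rw [← 𝒯.act_mul] at e
    obtain ⟨a, -, huniq⟩ := 𝒯.existsUnique_act_eq c (𝒯.act b c)
    have hbb : b = b' * ζ₀ := (huniq b rfl).trans (huniq (b' * ζ₀) e.symm).symm
    exact hζ₀ (by
      have : ζ₀ = b'⁻¹ * b := by rw [hbb, inv_mul_cancel_left]
      rw [this]; exact B₁.mul_mem (B₁.inv_mem hb') hb)
  have hc₁ : c ∈ R₁ := ⟨1, B₁.one_mem, by rw [𝒯.act_one]⟩
  have hc₂ : 𝒯.act ζ₀ c ∈ R₂ := ⟨1, B₁.one_mem, by rw [𝒯.act_one]⟩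
  refine ⟨R₁, R₂, hunion, hdisj, ⟨c, hc₁, rfl⟩, ⟨𝒯.act ζ₀ c, hc₂, rfl⟩,
    T.stabTransitive_of_stabChar S g 𝒯 B₁ R₁ ⟨c, hc₁, rfl⟩ hχ₁,
    T.stabTransitive_of_stabChar S g 𝒯 B₁ R₂ ⟨𝒯.act ζ₀ c, hc₂, rfl⟩ hχ₁, ?_⟩
  exact T.not_stabTransitive_of_stabChar_through S g 𝒯 B₁ R hthrough hcR hζ₀ (hR₂R hc₂)

/-! ### (R3) Remark 2.9.2 from the three stabiliser-character data -/

/-- **[EtTh] Rmk. 2.9.2 from the stabiliser characters** (reduction BY NAME).  Inputs: for `X̲̲` (member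
`tp Π_{X̲̲}`, data `𝒟Xuu`) — (a) at every cusp labelled `0`, `RXuu g` is a `μ_{2l}`-structure and the cusp stabiliser
REALISES all of `μ_{2l}` on classes (deck `μ_l` × inversion); (c) at every rational cusp with nonzero label, `RXuu g` is a
`μ_{2l}`-structure, `μ_l ≤ μ_{2l}` of index two (`ζ₀`), the stabiliser realises `μ_l` and acts only through `μ_l`; for
`X̲` (member `tp Π_{X̲}`) — (b) at every cusp a torsor datum and a structure group `B g` realised by the stabiliser with
`RXu g` a `B g`-structure (print: `μ₂`, the inversion).  Output: `Rmk292 𝒟Xuu RXuu RXu label0`.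
[cite: MochizukiEtTh2009, Rmk 2.9.2 p.43] -/
theorem rmk292_of_stabChar {A : Type u} [Group A] (𝒟Xuu : T.Cor28iiData (T.tp T.PiXuu) A)
    (RXuu : ∀ g, Set (T.cuspPairAt (T.tp T.PiXuu) g).SplittingClass)
    (RXu : ∀ g, Set (T.cuspPairAt (T.tp T.PiXu) g).SplittingClass) (label0 : Set T.Gtp)
    -- (a) label `0`: `μ_{2l}`-structure, stabiliser character ONTO `μ_{2l}`
    (hRa : ∀ g ∈ label0, (𝒟Xuu.torsor g).IsStructure (𝒟Xuu.mu (2 * l)) (RXuu g))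
    (hχa : ∀ g ∈ label0, ∀ ζ ∈ 𝒟Xuu.mu (2 * l), ∃ n ∈ T.cuspStabilizerReps (T.tp T.PiXuu) g, ∃ s ∈ T.tp T.PiXuu,
      MulAut.conj n • (T.cuspPairAt (T.tp T.PiXuu) g).D = MulAut.conj s • (T.cuspPairAt (T.tp T.PiXuu) g).D ∧
      ∀ (S₀ : Subgroup T.Gtp) (hS₀ : S₀ ∈ (T.cuspPairAt (T.tp T.PiXuu) g).splittings),
        ∃ h₀ : T.stabAct n s S₀ ∈ (T.cuspPairAt (T.tp T.PiXuu) g).splittings,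
          GalSect.CuspPair.SplittingClass.mk _ (T.stabAct n s S₀) h₀ =
            (𝒟Xuu.torsor g).act ζ (GalSect.CuspPair.SplittingClass.mk _ S₀ hS₀))
    -- (b) `X̲`: a torsor datum with structure group `B g` realised by the stabiliser, `RXu g` a `B g`-structure
    {A' : Type u} [Group A'] (𝒯Xu : ∀ g, (T.cuspPairAt (T.tp T.PiXu) g).TorsorData A') (B : T.Gtp → Subgroup A')
    (hRb : ∀ g, (𝒯Xu g).IsStructure (B g) (RXu g))
    (hχb : ∀ g, ∀ ζ ∈ B g, ∃ n ∈ T.cuspStabilizerReps (T.tp T.PiXu) g, ∃ s ∈ T.tp T.PiXu,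
      MulAut.conj n • (T.cuspPairAt (T.tp T.PiXu) g).D = MulAut.conj s • (T.cuspPairAt (T.tp T.PiXu) g).D ∧
      ∀ (S₀ : Subgroup T.Gtp) (hS₀ : S₀ ∈ (T.cuspPairAt (T.tp T.PiXu) g).splittings),
        ∃ h₀ : T.stabAct n s S₀ ∈ (T.cuspPairAt (T.tp T.PiXu) g).splittings,
          GalSect.CuspPair.SplittingClass.mk _ (T.stabAct n s S₀) h₀ =
            (𝒯Xu g).act ζ (GalSect.CuspPair.SplittingClass.mk _ S₀ hS₀))
    -- (c) nonzero labels: `μ_{2l}`-structure, `μ_l` of index two, character realises `μ_l` and acts through `μ_l`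
    (hRc : ∀ g, T.IsRationalCusp (T.tp T.PiXuu) g → g ∉ label0 →
      (𝒟Xuu.torsor g).IsStructure (𝒟Xuu.mu (2 * l)) (RXuu g))
    (hμ : 𝒟Xuu.mu l ≤ 𝒟Xuu.mu (2 * l)) {ζ₀ : A} (hζ₀B : ζ₀ ∈ 𝒟Xuu.mu (2 * l)) (hζ₀ : ζ₀ ∉ 𝒟Xuu.mu l)
    (hcoset : ∀ ζ ∈ 𝒟Xuu.mu (2 * l), ζ ∈ 𝒟Xuu.mu l ∨ ζ * ζ₀⁻¹ ∈ 𝒟Xuu.mu l)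
    (hχc : ∀ g, T.IsRationalCusp (T.tp T.PiXuu) g → g ∉ label0 → ∀ ζ ∈ 𝒟Xuu.mu l,
      ∃ n ∈ T.cuspStabilizerReps (T.tp T.PiXuu) g, ∃ s ∈ T.tp T.PiXuu,
      MulAut.conj n • (T.cuspPairAt (T.tp T.PiXuu) g).D = MulAut.conj s • (T.cuspPairAt (T.tp T.PiXuu) g).D ∧
      ∀ (S₀ : Subgroup T.Gtp) (hS₀ : S₀ ∈ (T.cuspPairAt (T.tp T.PiXuu) g).splittings),
        ∃ h₀ : T.stabAct n s S₀ ∈ (T.cuspPairAt (T.tp T.PiXuu) g).splittings,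
          GalSect.CuspPair.SplittingClass.mk _ (T.stabAct n s S₀) h₀ =
            (𝒟Xuu.torsor g).act ζ (GalSect.CuspPair.SplittingClass.mk _ S₀ hS₀))
    (hthrough : ∀ g, T.IsRationalCusp (T.tp T.PiXuu) g → g ∉ label0 →
      ∀ n ∈ T.cuspStabilizerReps (T.tp T.PiXuu) g, ∀ s ∈ T.tp T.PiXuu,
      MulAut.conj n • (T.cuspPairAt (T.tp T.PiXuu) g).D = MulAut.conj s • (T.cuspPairAt (T.tp T.PiXuu) g).D →
      ∀ (S₀ : Subgroup T.Gtp) (hS₀ : S₀ ∈ (T.cuspPairAt (T.tp T.PiXuu) g).splittings)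
        (h₀ : T.stabAct n s S₀ ∈ (T.cuspPairAt (T.tp T.PiXuu) g).splittings),
        GalSect.CuspPair.SplittingClass.mk _ S₀ hS₀ ∈ RXuu g →
        ∃ ζ ∈ 𝒟Xuu.mu l, GalSect.CuspPair.SplittingClass.mk _ (T.stabAct n s S₀) h₀ =
          (𝒟Xuu.torsor g).act ζ (GalSect.CuspPair.SplittingClass.mk _ S₀ hS₀)) :
    Literature.AnabelianGeometry.EtaleTheta.ThetaCovers.TemperedCoverData.Rmk292 T 𝒟Xuu RXuu RXu label0 :=
  ⟨fun g hg => T.stabTransitive_of_stabChar _ g (𝒟Xuu.torsor g) _ _ (hRa g hg) (hχa g hg),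
    fun g => T.stabTransitive_of_stabChar _ g (𝒯Xu g) (B g) _ (hRb g) (hχb g),
    fun g hrat hg => T.stabTwoMuOrbits_of_stabChar _ g (𝒟Xuu.torsor g) _ _ hμ hζ₀B hζ₀ hcoset (RXuu g)
      (hRc g hrat hg) (hχc g hrat hg) (hthrough g hrat hg)⟩

end TemperedCoverData

end ThetaCovers

end Literature.AnabelianGeometry.EtaleTheta

end
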